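import Summits.QuantumFields.BalabanUV.Beta.GAN24.WoodburyFibreZeroModeGainStep
import Summits.QuantumFields.BalabanUV.Beta.GAN24.SrecChargeBm
import Summits.QuantumFields.BalabanUV.Beta.GAN24.BiStencilZeroMode

/-!
# `BalabanUV.Beta.GAN24.CoDressedFieldRowSums` — binder row G-an2-4 ∕ (CONV-C), CT-W «WC-TL» → «QR-LL», the (S) row, Ward-type half (W-γ) in the plain currency, ingredient (i)
# of the (T-F) route (road-P2 g39 memo `W-GAMMA-ROUTE-v1.md` §3; leaf-06 g45 W4 (B) «the missing row law `Σ'_u coDressKBmAt ρ Lc K u p (inl κ) c`»):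
# **THE FIELD–FIELD BLOCK OF THE (CO-DRESSED) STEP RESOLVENT HAS ZERO TOTAL OVER ITS FIRST FIELD LEG** — `Σ'_u G_j u x (inl κ) (inl β) = 0` for
# `G_j = coDressKBmAt ρ Lc (KInvStep Lc j)` (and for `KInvStep Lc j` itself), every `x κ β j`, in-block root (road-P2 chair `b2b-balaban-gan24-p2`, gen 39, INTENT 3).

NOT IN PRINT; OUR BOOKKEEPING ([folklore]: gan24-p3's `WoodburyFibreZeroModeGainStep.contourSum_blockFF_KInvStep_left` («every field column of `KInvStep` has zero straight-contour sums»,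
= pv∕an1's `KKTFluctuationKernel.Gam_Q` decimated) summed over all contours — the straight `Lc`-contours cover every fine bond exactly `Lc` times —, then the window form of the
co-dressing and leaf-02 g51's `SrecChargeBm.tsum_coProjBmW` (the left dressing preserves leg totals); 0 `def`, 0 cited fact, 0 `def … : Prop`, 0 sorry).  HONEST FRAMING (cell contract,
verbatim): «discharging `BetaPertH` makes Bałaban's UV stability UNCONDITIONAL — a real constructive-QFT result; it is NOT the continuum limit and NOT the Clay problem.»  HONEST
DEPENDENCY (verbatim): «continuum YM on T⁴ ⇐ BetaPertH ∧ nine spine estimates (0/9 proved); BetaPertH ⇐ (D1) ∧ (D4) ∧ CAP+tail; G-an2-4 gates asym, D1 and NE2/3/4.»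

WHAT.
* §1 `tsum_contourSum_eq` — THE COVER COUNT: for summable `f`, `Σ'_u Σ_{b∈box} Σ_{s<Lc} f (Lc•u + b + s•e_κ) = Lc·Σ'_x f x`.
* §2 **`tsum_KInvStep_inl_inl_left`**: `Σ'_x KInvStep Lc j x y (inl κ) (inl β) = 0` (every `y κ β j`): the response at a field leg to a CONSTANT force on all `κ`-legs has no field part
  («a constant force is absorbed by the constraint multiplier»; on the engine SDF-1 `G·1^F_κ = (0, −Lc⁻¹·1^M_κ)` exactly, E26g).
* §3 the window form of the co-dressed field–field entry (`coDressKBmAt_inl_inl`) and **`tsum_coDressKBmAt_inl_inl_left`**: for ANY `K` whose field–field columns have zero first-leg totals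
  (and are summable), `Σ'_u coDressKBmAt ρ N K u x (inl κ) (inl β) = 0`; the instance **`tsum_coDressKBmAt_KInvStep_inl_inl_left`** for `G_j`.
Together with `WardResidualRotatedVertexTotals.tsum_colH_comb_eq` (the field–MULTIPLIER first-leg totals = exit-slice `colMass` sums) this is the complete first-field-leg ROW LAW of `G_j`
that the (γ) total read weight `W^γ_κ = Σ'_u (G_j ∘ dM …)(u, ·)` consumes (leaf-06's (T-F)).  Asserts NO value of Bałaban's tables; discharges NOTHING of (S) ∕ (Q-R) ∕ (LT) ∕ (Q-L) ∕ (C) ∕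
«T2Shape» ∕ «T2Drift» ∕ (hW, hWall); NEVER «G-an2-4 closed» as (CONV-C); NOT D1, NOT BetaPertH, NOT continuum, NOT Clay.  2026-08-22; no existing file touched.
-/

noncomputable section

open Finset
open scoped BigOperators
open Literature.MathematicalPhysics.QuantumFieldTheory
open Literature.MathematicalPhysics.QuantumFieldTheory.Balaban1983to89
open Literature.MathematicalPhysics.QuantumFieldTheory.Balaban1983to89.Beta
open ExpKernelCalculus (Site MKer Decays)
open AffineAveraging (Form1 box toSite contourSum unitVec)
open OneStepResolventKernel (Fib)
open OneStepKernelFamily (KInvStep decays_KInvStep)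
open Summit.QuantumFields.BalabanUV.Beta.TameKernelCalculus (trK)
open Summit.QuantumFields.BalabanUV.Beta.AxialDressingRooted (pmBm cube coProjBmW coProjBmW_apply coDressKBmAt coDressKBmAt_eq piKBm piKBm_inr_inl
  sum_piKBm_col_inl abs_pmBm_le tsum_window')
open Summit.QuantumFields.BalabanUV.Beta.GAN24.SrecChargeBm (tsum_coProjBmW)
open Summit.QuantumFields.BalabanUV.Beta.GAN24.WoodburyFibreBlocks (blockFF)
open Summit.QuantumFields.BalabanUV.Beta.GAN24.WoodburyFibreZeroModeGainStep (contourSum_blockFF_KInvStep_left)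
open Summit.QuantumFields.BalabanUV.Beta.GAN24.BiStencilZeroMode (tsum_eq_sum_box_tsum)

namespace Summit.QuantumFields.BalabanUV.Beta.GAN24.CoDressedFieldRowSums

variable {d : ℕ} {Lc : ℕ} [NeZero Lc]

/-! ## §1 The cover count: straight `Lc`-contours cover every fine bond `Lc` times -/

/-- [folklore] **COVER COUNT**: for a summable `f` on the fine lattice, `Σ'_u Σ_{b∈box} Σ_{s<Lc} f (Lc•u + b + s•e_κ) = Lc·Σ'_x f x` (block regrouping
`BiStencilZeroMode.tsum_eq_sum_box_tsum` for each shift `s`, then translation invariance of the series). -/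
theorem tsum_sum_box_range_eq {f : Site (d + 1) → ℝ} (hf : Summable f) (κ : Fin (d + 1)) :
    ∑' u : Site (d + 1), ∑ b ∈ box (d + 1) Lc, ∑ s ∈ Finset.range Lc, f ((Lc : ℤ) • u + toSite b + (s : ℤ) • unitVec κ)
      = (Lc : ℝ) * ∑' x : Site (d + 1), f x := by
  -- each (b, s)-slice is a translate of a sublattice sample of `f`, hence summable
  have hsl : ∀ (b : Fin (d + 1) → ℕ) (s : ℕ), Summable fun u : Site (d + 1) => f ((Lc : ℤ) • u + toSite b + (s : ℤ) • unitVec κ) := by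
    intro b s
    have h := (hf.comp_injective ((add_left_injective ((s : ℤ) • unitVec κ)))).comp_injective
      (InterLevelTransport.sublattice_injective Lc (toSite b))
    exact h.congr fun u => by simp [Function.comp]
  rw [Summable.tsum_finsetSum (fun b _ => summable_sum fun s _ => hsl b s)]
  simp_rw [Summable.tsum_finsetSum (fun s _ => hsl _ s)]
  rw [Finset.sum_comm]
  have hshift : ∀ s ∈ Finset.range Lc, ∑ b ∈ box (d + 1) Lc, ∑' u : Site (d + 1), f ((Lc : ℤ) • u + toSite b + (s : ℤ) • unitVec κ) = ∑' x, f x := by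
    intro s _
    have h1 := tsum_eq_sum_box_tsum (N := Lc) (hf.comp_injective (add_left_injective ((s : ℤ) • unitVec κ)))
    simp only [Function.comp] at h1
    rw [← (Equiv.addRight ((s : ℤ) • unitVec κ)).tsum_eq f]
    simp only [Equiv.coe_addRight]
    exact h1.symm
  rw [Finset.sum_congr rfl hshift, Finset.sum_const, Finset.card_range, nsmul_eq_mul]

/-! ## §2 The undressed step resolvent: zero first-field-leg totals of the field–field block -/

/-- NOT IN PRINT; OUR BOOKKEEPING.  **`Σ'_x KInvStep Lc j x y (inl κ) (inl β) = 0`** for every `y κ β j`: gan24-p3's `contourSum_blockFF_KInvStep_left` («every field column has zero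
straight-contour sums in its first variable», every coarse point) summed over all contours with §1's cover count; the column is summable by `decays_KInvStep`. -/
theorem tsum_KInvStep_inl_inl_left (j : ℕ) (y : Site (d + 1)) (κ β : Fin (d + 1)) :
    ∑' x : Site (d + 1), KInvStep (d := d) Lc j x y (Sum.inl κ) (Sum.inl β) = 0 := by
  obtain ⟨δ, C, hδ, -, hK⟩ := decays_KInvStep (d := d) (Lc := Lc) j
  have hs : Summable fun x : Site (d + 1) => KInvStep (d := d) Lc j x y (Sum.inl κ) (Sum.inl β) :=
    AxialDressing.summable_col_of_decays hK hδ y (Sum.inl κ) (Sum.inl β)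
  have hcover := tsum_sum_box_range_eq (Lc := Lc) hs κ
  have hzero : ∀ u : Site (d + 1), ∑ b ∈ box (d + 1) Lc, ∑ s ∈ Finset.range Lc,
      KInvStep (d := d) Lc j ((Lc : ℤ) • u + toSite b + (s : ℤ) • unitVec κ) y (Sum.inl κ) (Sum.inl β) = 0 := by
    intro u
    have h := contourSum_blockFF_KInvStep_left (d := d) (Lc := Lc) j y (Sum.inl β) κ u
    simpa only [contourSum, blockFF] using h
  simp only [hzero, tsum_zero] at hcover
  have hL : (Lc : ℝ) ≠ 0 := by exact_mod_cast NeZero.ne Lc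
  exact (mul_eq_zero.1 hcover.symm).resolve_left hL


/-! ## §3 The co-dressed kernel: window form of the field–field entry and its zero first-leg total -/

section CoDress

variable {N : ℕ} [NeZero N]

omit [NeZero N] in
/-- [folklore] **WINDOW FORM OF THE CO-DRESSED FIELD–FIELD ENTRY** (the `(inl, inl)` companion of an2's `colH_coDressKBmAt`):
`coDressKBmAt ρ N K u′ x (inl κ′) (inl β′) = Σ_{w∈cube} Σ_β pmBm ρ N β′ x β (x − w)·(Σ_{v∈cube} Σ_α pmBm ρ N κ′ u′ α (u′ − v)·K (u′ − v) (x − w) (inl α) (inl β))`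
— both dressings are finite window sums; the inner one is `coProjBmW ρ N (fun α p ↦ K p (x − w) (inl α) (inl β)) κ′ u′`. -/
theorem coDressKBmAt_inl_inl (ρ : Site (d + 1)) (K : MKer (d + 1) (Fib d)) (u' x : Site (d + 1)) (κ' β' : Fin (d + 1)) :
    coDressKBmAt ρ N K u' x (Sum.inl κ') (Sum.inl β')
      = ∑ w ∈ cube (d + 1) N, ∑ β : Fin (d + 1), pmBm ρ N β' x β (x - w)
          * coProjBmW ρ N (fun α p => K p (x - w) (Sum.inl α) (Sum.inl β)) κ' u' := by
  rw [coDressKBmAt_eq]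
  -- outer composition: the right factor is the window of `x`
  have hout : ExpKernelCalculus.comp (ExpKernelCalculus.comp (trK (piKBm ρ N)) K) (piKBm ρ N) u' x (Sum.inl κ') (Sum.inl β')
      = ∑' q : Site (d + 1), (if x - q ∈ cube (d + 1) N then
          ∑ β : Fin (d + 1), pmBm ρ N β' x β q * ExpKernelCalculus.comp (trK (piKBm ρ N)) K u' q (Sum.inl κ') (Sum.inl β) else 0) := by
    unfold ExpKernelCalculus.comp
    refine tsum_congr fun q => ?_
    have h := sum_piKBm_col_inl ρ N q x β' (fun f => ∑' p : Site (d + 1), ∑ g : Fib d, trK (piKBm ρ N) u' p (Sum.inl κ') g * K p q g f)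
    rw [← h]
    exact Finset.sum_congr rfl fun f _ => mul_comm _ _
  rw [hout, tsum_window']
  refine Finset.sum_congr rfl fun w _ => Finset.sum_congr rfl fun β _ => ?_
  congr 1
  -- inner composition: the left factor is the window of `u′`
  unfold ExpKernelCalculus.comp
  simp only [trK]
  have h2 : ∀ p : Site (d + 1), ∑ g : Fib d, piKBm ρ N p u' g (Sum.inl κ') * K p (x - w) g (Sum.inl β)
      = if u' - p ∈ cube (d + 1) N then ∑ α : Fin (d + 1), pmBm ρ N κ' u' α p * K p (x - w) (Sum.inl α) (Sum.inl β) else 0 :=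
    fun p => sum_piKBm_col_inl ρ N p u' κ' (fun g => K p (x - w) g (Sum.inl β))
  simp_rw [h2]
  rw [tsum_window', coProjBmW_apply]

omit [NeZero N] in
/-- [folklore] `coProjBmW` of a summable weight family is summable (finite window of bounded `pmBm` weights against translates). -/
theorem summable_coProjBmW (hN : 1 ≤ N) {r : Fin (d + 1) → ℕ} (hr : r ∈ box (d + 1) N) {A : Form1 (d + 1) ℝ} (hA : ∀ κ, Summable (A κ))
    (κ' : Fin (d + 1)) : Summable fun u' : Site (d + 1) => coProjBmW (toSite r) N A κ' u' := by
  simp only [coProjBmW_apply]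
  refine summable_sum fun v _ => summable_sum fun κ _ => ?_
  have hs : Summable fun u' : Site (d + 1) => A κ (u' - v) := (Equiv.subRight v).summable_iff.2 (hA κ)
  refine Summable.of_norm_bounded (hs.abs.mul_left (1 + 4 * (((d : ℝ) + 1) * N))) fun u' => ?_
  rw [Real.norm_eq_abs, abs_mul]
  exact mul_le_mul_of_nonneg_right (abs_pmBm_le hN hr κ' u' κ (u' - v)) (abs_nonneg _)

/-- NOT IN PRINT; OUR BOOKKEEPING.  **THE CO-DRESSING PRESERVES ZERO FIRST-FIELD-LEG TOTALS OF THE FIELD–FIELD BLOCK**: if every field–field column of `K` is summable in its first leg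
with total `0`, then `Σ'_u coDressKBmAt ρ N K u x (inl κ′) (inl β′) = 0` (in-block root; window form + leaf-02 g51's `tsum_coProjBmW`). -/
theorem tsum_coDressKBmAt_inl_inl_left (hN : 1 ≤ N) {r : Fin (d + 1) → ℕ} (hr : r ∈ box (d + 1) N) {K : MKer (d + 1) (Fib d)}
    (hKs : ∀ (q : Site (d + 1)) (α β : Fin (d + 1)), Summable fun p : Site (d + 1) => K p q (Sum.inl α) (Sum.inl β))
    (hK0 : ∀ (q : Site (d + 1)) (α β : Fin (d + 1)), ∑' p : Site (d + 1), K p q (Sum.inl α) (Sum.inl β) = 0)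
    (x : Site (d + 1)) (κ' β' : Fin (d + 1)) :
    ∑' u' : Site (d + 1), coDressKBmAt (toSite r) N K u' x (Sum.inl κ') (Sum.inl β') = 0 := by
  simp only [coDressKBmAt_inl_inl]
  have hA : ∀ (w : Site (d + 1)) (β : Fin (d + 1)) (α : Fin (d + 1)), Summable ((fun α p => K p (x - w) (Sum.inl α) (Sum.inl β)) α) :=
    fun w β α => hKs (x - w) α β
  have hterm : ∀ (w : Site (d + 1)) (β : Fin (d + 1)), Summable fun u' : Site (d + 1) =>
      pmBm (toSite r) N β' x β (x - w) * coProjBmW (toSite r) N (fun α p => K p (x - w) (Sum.inl α) (Sum.inl β)) κ' u' :=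
    fun w β => (summable_coProjBmW hN hr (hA w β) κ').mul_left _
  rw [Summable.tsum_finsetSum (fun w _ => summable_sum fun β _ => hterm w β)]
  refine Finset.sum_eq_zero fun w _ => ?_
  rw [Summable.tsum_finsetSum (fun β _ => hterm w β)]
  refine Finset.sum_eq_zero fun β _ => ?_
  rw [tsum_mul_left, tsum_coProjBmW hr (hA w β) κ', hK0, mul_zero]

/-- NOT IN PRINT; OUR BOOKKEEPING.  **THE COMB KERNEL's FIELD–FIELD BLOCK HAS ZERO FIRST-FIELD-LEG TOTALS**: for `G_j = coDressKBmAt ρ Lc (KInvStep Lc j)` (in-block root, any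
level `j`), `Σ'_u G_j u x (inl κ′) (inl β′) = 0` for every `x κ′ β′` — §3 over §2.  (Its companion on the field–MULTIPLIER block is
`WardResidualRotatedVertexTotals.tsum_colH_comb_eq`; together: the first-field-leg row law of `G_j`, engine-exact as `G·1^F_κ = (0, −Lc⁻¹·1^M_κ)`, E26g.) -/
theorem tsum_coDressKBmAt_KInvStep_inl_inl_left {r : Fin (d + 1) → ℕ} (hr : r ∈ box (d + 1) Lc) (j : ℕ) (x : Site (d + 1)) (κ' β' : Fin (d + 1)) :
    ∑' u' : Site (d + 1), coDressKBmAt (toSite r) Lc (KInvStep (d := d) Lc j) u' x (Sum.inl κ') (Sum.inl β') = 0 := by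
  obtain ⟨δ, C, hδ, -, hK⟩ := decays_KInvStep (d := d) (Lc := Lc) j
  exact tsum_coDressKBmAt_inl_inl_left NeZero.one_le hr
    (fun q α β => AxialDressing.summable_col_of_decays hK hδ q (Sum.inl α) (Sum.inl β))
    (fun q α β => tsum_KInvStep_inl_inl_left (d := d) (Lc := Lc) j q α β) x κ' β'

end CoDress

end Summit.QuantumFields.BalabanUV.Beta.GAN24.CoDressedFieldRowSums

end
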